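import Mathlib
import Literature.NumberTheory.EllipticCurves.RealPeriod
import HarnessLib

/-!
# The normalized period integral is `≤ A + B · |log |D||`

Stub `stub_normalizedPeriodIntegral` (C) of line `Sketch` for the crux `SomeWindowSaving`
(stmt-ABC-1976), card A (period quantisation).  For the normalized two-torsion cubic
`p(s) = 4s³ − G₂ s − G₃` with `|G₂|, |G₃| ≤ 1`, `|G₂| = 1 ∨ |G₃| = 1` and discriminant
`D = G₂³ − 27 G₃² ≠ 0`, the two sublevel-set estimates

* (B1) `vol {s ∈ [−2,2] : 0 < p(s) < η} ≤ C₁ η / |D|` for `0 < η ≤ c₁ |D|`,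
* (B2) `vol {s ∈ [−2,2] : 0 < p(s) < η} ≤ C₂ √η` for `0 < η ≤ η₀`,

imply `∫_{p > 0} ds / √p(s) ≤ A + B |log |D||` with constants `A, B ≥ 0` depending only on
`c₁, C₁, η₀, C₂`.

## Proof

Everything is done with the lower Lebesgue integral `∫⁻` (no integrability is needed: the Bochner
integral of the non-negative integrand is the `toReal` of the `lintegral`, and subadditivity of
`∫⁻` over countable covers is free).  The set `{p > 0}` is covered by

* the tail `(2, ∞)`, where `p(s) ≥ s³`, so the integrand is `≤ s^{-3/2}`, whose integral over
  `(2, ∞)` is a finite absolute constant (`integrableOn_Ioi_rpow_of_lt`);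
* the high part `{s ∈ [−2,2] : η₀/4 < p(s)}`, where the integrand is `≤ 2/√η₀` (volume `≤ 4`);
* the dyadic shells `Eₙ = {s ∈ [−2,2] : (uₙ/2)² < p(s) ≤ uₙ²}`, `uₙ = (√η₀/2)·2⁻ⁿ`, on which the
  integrand is `≤ 2/uₙ` and whose volume is bounded through the slice at level `(2uₙ)² ≤ η₀`:
  by (B2) each shell contributes `≤ 4 C₂`; by (B1) the shells `n = N + j` with `2^{-N} ≤ κ|D|`
  (`κ = min(1, c₁/(28 η₀))`, so that `(2u_{N+j})² ≤ η₀ κ² |D|² ≤ c₁ |D|` as `|D| ≤ 28`) contribute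
  `≤ 4 C₁ √η₀ κ 2^{-j}`, a geometric series.  With `N = ⌈log₂ (1/(κ|D|))⌉₊ ≤ 1 +
  (log (1/κ) + |log |D||)/log 2` the total is `A + B |log |D||`.

(`p(s) ≤ 0` for `s ≤ −2`, so nothing is lost on `(−∞, −2)`.)  No auxiliary definitions: the
shells, slices and the integrand are written out in full.
-/

noncomputable section

-- `Summit.ABC.ABC` is the mandated summit-side namespace (single-conjunct summit).
set_option linter.dupNamespace false

open MeasureTheory Set
open scoped ENNReal

namespace Summit.ABC.ABC.Theorems

namespace NormalizedPeriodIntegral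

/-! ### Elementary estimates for the normalized cubic `p(s) = 4s³ − G₂ s − G₃` -/

/-- `p(s) ≤ 0` for `s ≤ −2` when `|G₂|, |G₃| ≤ 1`; equivalently `{p > 0} ⊆ (−2, ∞)`. -/
theorem neg_two_lt {G₂ G₃ s : ℝ} (hG₂ : |G₂| ≤ 1) (hG₃ : |G₃| ≤ 1)
    (hp : 0 < 4 * s ^ 3 - G₂ * s - G₃) : -2 < s := by
  by_contra! h
  obtain ⟨hG₂l, hG₂u⟩ := abs_le.mp hG₂
  obtain ⟨hG₃l, hG₃u⟩ := abs_le.mp hG₃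
  have ht : 0 ≤ -2 - s := by linarith
  nlinarith [mul_nonneg (mul_nonneg ht ht) ht, mul_nonneg ht ht,
    mul_nonneg (by linarith : (0 : ℝ) ≤ 1 - G₂) (by linarith : (0 : ℝ) ≤ -s),
    mul_nonneg (by linarith : (0 : ℝ) ≤ 1 + G₂) (by linarith : (0 : ℝ) ≤ -s)]

/-- `s³ ≤ p(s)` for `s ≥ 1` when `|G₂|, |G₃| ≤ 1`. -/
theorem cube_le {G₂ G₃ s : ℝ} (hG₂ : |G₂| ≤ 1) (hG₃ : |G₃| ≤ 1) (hs : 1 ≤ s) :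
    s ^ 3 ≤ 4 * s ^ 3 - G₂ * s - G₃ := by
  obtain ⟨hG₂l, hG₂u⟩ := abs_le.mp hG₂
  obtain ⟨hG₃l, hG₃u⟩ := abs_le.mp hG₃
  have hs0 : 0 ≤ s := by linarith
  have h1 : G₂ * s ≤ s := by nlinarith
  have h2 : s ≤ s ^ 3 := by nlinarith [mul_le_mul hs hs zero_le_one hs0]
  nlinarith

/-- `|D| = |G₂³ − 27 G₃²| ≤ 28` when `|G₂|, |G₃| ≤ 1`. -/
theorem abs_disc_le {G₂ G₃ : ℝ} (hG₂ : |G₂| ≤ 1) (hG₃ : |G₃| ≤ 1) :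
    |G₂ ^ 3 - 27 * G₃ ^ 2| ≤ 28 := by
  have h1 : |G₂ ^ 3| ≤ 1 := by
    rw [abs_pow]; exact pow_le_one₀ (abs_nonneg _) hG₂
  have h2 : |27 * G₃ ^ 2| ≤ 27 := by
    rw [abs_mul, abs_pow, abs_of_pos (by norm_num : (0 : ℝ) < 27)]
    have : |G₃| ^ 2 ≤ 1 := pow_le_one₀ (abs_nonneg _) hG₃
    linarith
  exact (abs_sub _ _).trans (by linarith)

/-! ### The pieces of the cover -/

/-- On a set where `e ≤ p` (`0 < e`) the `lintegral` of `1/√p` is `≤ (1/√e) · volume`. -/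
theorem setLIntegral_le {G₂ G₃ e : ℝ} {T : Set ℝ} (he : 0 < e)
    (hT : ∀ s ∈ T, e ≤ 4 * s ^ 3 - G₂ * s - G₃) :
    ∫⁻ s in T, ENNReal.ofReal ((Real.sqrt (4 * s ^ 3 - G₂ * s - G₃))⁻¹) ≤
      ENNReal.ofReal ((Real.sqrt e)⁻¹) * volume T :=
  calc ∫⁻ s in T, ENNReal.ofReal ((Real.sqrt (4 * s ^ 3 - G₂ * s - G₃))⁻¹)
      ≤ ∫⁻ _ in T, ENNReal.ofReal ((Real.sqrt e)⁻¹) :=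
        setLIntegral_mono measurable_const fun s hs => ENNReal.ofReal_le_ofReal
          (inv_anti₀ (Real.sqrt_pos.mpr he) (Real.sqrt_le_sqrt (hT s hs)))
    _ = ENNReal.ofReal ((Real.sqrt e)⁻¹) * volume T := setLIntegral_const _ _

/-- **Shell estimate**: on `E = {s ∈ [−2,2] : (u/2)² < p(s) ≤ u²}` (`0 < u`),
`∫_E ds/√p ≤ (2/u) · vol {s ∈ [−2,2] : 0 < p(s) < (2u)²}`. -/
theorem shell_le {G₂ G₃ u : ℝ} (hu : 0 < u) :
    ∫⁻ s in {s : ℝ | s ∈ Icc (-2 : ℝ) 2 ∧ (u / 2) ^ 2 < 4 * s ^ 3 - G₂ * s - G₃ ∧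
        4 * s ^ 3 - G₂ * s - G₃ ≤ u ^ 2}, ENNReal.ofReal ((Real.sqrt (4 * s ^ 3 - G₂ * s - G₃))⁻¹) ≤
      ENNReal.ofReal (2 / u) * volume {s : ℝ | s ∈ Icc (-2 : ℝ) 2 ∧
        0 < 4 * s ^ 3 - G₂ * s - G₃ ∧ 4 * s ^ 3 - G₂ * s - G₃ < (2 * u) ^ 2} := by
  have h := setLIntegral_le (G₂ := G₂) (G₃ := G₃) (by positivity : 0 < (u / 2) ^ 2)
    (T := {s : ℝ | s ∈ Icc (-2 : ℝ) 2 ∧ (u / 2) ^ 2 < 4 * s ^ 3 - G₂ * s - G₃ ∧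
      4 * s ^ 3 - G₂ * s - G₃ ≤ u ^ 2}) fun s hs => hs.2.1.le
  rw [Real.sqrt_sq (by positivity), inv_div] at h
  refine h.trans (mul_le_mul_right (measure_mono fun s hs => ?_) _)
  refine ⟨hs.1, lt_of_le_of_lt (by positivity) hs.2.1, lt_of_le_of_lt hs.2.2 ?_⟩
  nlinarith

/-- **High part**: `∫_{[−2,2] ∩ {p > η₀/4}} ds/√p ≤ 8/√η₀`. -/
theorem high_le {G₂ G₃ η₀ : ℝ} (hη₀ : 0 < η₀) :
    ∫⁻ s in {s : ℝ | s ∈ Icc (-2 : ℝ) 2 ∧ η₀ / 4 < 4 * s ^ 3 - G₂ * s - G₃},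
        ENNReal.ofReal ((Real.sqrt (4 * s ^ 3 - G₂ * s - G₃))⁻¹) ≤
      ENNReal.ofReal (8 / Real.sqrt η₀) := by
  have hsq : 0 < Real.sqrt η₀ := Real.sqrt_pos.mpr hη₀
  have he : (Real.sqrt η₀ / 2) ^ 2 = η₀ / 4 := by rw [div_pow, Real.sq_sqrt hη₀.le]; norm_num
  have h := setLIntegral_le (G₂ := G₂) (G₃ := G₃) (by positivity : 0 < (Real.sqrt η₀ / 2) ^ 2)
    (T := {s : ℝ | s ∈ Icc (-2 : ℝ) 2 ∧ η₀ / 4 < 4 * s ^ 3 - G₂ * s - G₃})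
    fun s hs => by rw [he]; exact hs.2.le
  rw [Real.sqrt_sq (by positivity), inv_div] at h
  refine h.trans ((mul_le_mul_right (measure_mono fun s hs => hs.1) _).trans ?_)
  rw [Real.volume_Icc, ← ENNReal.ofReal_mul (by positivity)]
  exact le_of_eq (by congr 1; ring)

/-- The tail constant `∫_{(2,∞)} s^{-3/2} ds` is finite. -/
theorem tail_lt_top : ∫⁻ s in Ioi (2 : ℝ), ENNReal.ofReal (s ^ (-(3 / 2 : ℝ))) < ∞ :=
  Integrable.lintegral_lt_top
    (integrableOn_Ioi_rpow_of_lt (by norm_num) (by norm_num : (0 : ℝ) < 2))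

/-- **Tail**: `∫_{(2,∞)} ds/√p ≤ ∫_{(2,∞)} s^{-3/2} ds`, since `p(s) ≥ s³` there. -/
theorem tail_le {G₂ G₃ : ℝ} (hG₂ : |G₂| ≤ 1) (hG₃ : |G₃| ≤ 1) :
    ∫⁻ s in Ioi (2 : ℝ), ENNReal.ofReal ((Real.sqrt (4 * s ^ 3 - G₂ * s - G₃))⁻¹) ≤
      ∫⁻ s in Ioi (2 : ℝ), ENNReal.ofReal (s ^ (-(3 / 2 : ℝ))) := by
  refine setLIntegral_mono (by fun_prop) fun s hs => ?_
  have hs2 : (2 : ℝ) < s := hs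
  have hs0 : 0 < s := by linarith
  have hcube := cube_le hG₂ hG₃ (by linarith : (1 : ℝ) ≤ s)
  refine ENNReal.ofReal_le_ofReal ?_
  calc (Real.sqrt (4 * s ^ 3 - G₂ * s - G₃))⁻¹ ≤ (Real.sqrt (s ^ 3))⁻¹ :=
        inv_anti₀ (Real.sqrt_pos.mpr (by positivity)) (Real.sqrt_le_sqrt hcube)
    _ = s ^ (-(3 / 2) : ℝ) := by
        rw [Real.sqrt_eq_rpow, ← Real.rpow_natCast, ← Real.rpow_mul hs0.le, Real.rpow_neg hs0.le]
        norm_num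

/-- **Cover**: `{p > 0} ⊆ (2,∞) ∪ (high part) ∪ ⋃_{n<N} Eₙ ∪ ⋃ⱼ E_{N+j}` for every `N`, where
`Eₙ = {s ∈ [−2,2] : (uₙ/2)² < p(s) ≤ uₙ²}` for any levels with `uₙ² = (η₀/4)·4⁻ⁿ`. -/
theorem cover {G₂ G₃ η₀ : ℝ} (hG₂ : |G₂| ≤ 1) (hG₃ : |G₃| ≤ 1) (hη₀ : 0 < η₀) {u : ℕ → ℝ}
    (hu : ∀ n, u n ^ 2 = η₀ / 4 * (1 / 4) ^ n) (N : ℕ) :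
    {s : ℝ | 0 < 4 * s ^ 3 - G₂ * s - G₃} ⊆
      ((Ioi (2 : ℝ) ∪ {s : ℝ | s ∈ Icc (-2 : ℝ) 2 ∧ η₀ / 4 < 4 * s ^ 3 - G₂ * s - G₃}) ∪
        ⋃ i : Fin N, {s : ℝ | s ∈ Icc (-2 : ℝ) 2 ∧ (u i / 2) ^ 2 < 4 * s ^ 3 - G₂ * s - G₃ ∧
          4 * s ^ 3 - G₂ * s - G₃ ≤ u i ^ 2}) ∪
        ⋃ j : ℕ, {s : ℝ | s ∈ Icc (-2 : ℝ) 2 ∧ (u (N + j) / 2) ^ 2 < 4 * s ^ 3 - G₂ * s - G₃ ∧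
          4 * s ^ 3 - G₂ * s - G₃ ≤ u (N + j) ^ 2} := by
  intro s hs
  simp only [mem_setOf_eq] at hs
  by_cases h2 : 2 < s
  · exact Or.inl (Or.inl (Or.inl h2))
  have hIcc : s ∈ Icc (-2 : ℝ) 2 := ⟨(neg_two_lt hG₂ hG₃ hs).le, not_lt.mp h2⟩
  rcases lt_or_ge (η₀ / 4) (4 * s ^ 3 - G₂ * s - G₃) with hhigh | hhigh
  · exact Or.inl (Or.inl (Or.inr ⟨hIcc, hhigh⟩))
  obtain ⟨n, hn1, hn2⟩ := exists_nat_pow_near_of_lt_one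
    (x := (4 * s ^ 3 - G₂ * s - G₃) / (η₀ / 4)) (y := 1 / 4) (by positivity)
    ((div_le_one (by positivity)).mpr hhigh) (by norm_num) (by norm_num)
  have hmem : s ∈ Icc (-2 : ℝ) 2 ∧ (u n / 2) ^ 2 < 4 * s ^ 3 - G₂ * s - G₃ ∧
      4 * s ^ 3 - G₂ * s - G₃ ≤ u n ^ 2 := by
    refine ⟨hIcc, ?_, ?_⟩
    · have := (lt_div_iff₀ (by positivity)).mp hn1
      rw [pow_succ] at this
      calc (u n / 2) ^ 2 = (1 / 4 : ℝ) ^ n * (1 / 4) * (η₀ / 4) := by rw [div_pow, hu]; ring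
        _ < _ := this
    · rw [hu, mul_comm (η₀ / 4)]
      exact (div_le_iff₀ (by positivity)).mp hn2
  by_cases hn : n < N
  · exact Or.inl (Or.inr (mem_iUnion.mpr ⟨⟨n, hn⟩, hmem⟩))
  · refine Or.inr (mem_iUnion.mpr ⟨n - N, ?_⟩)
    rwa [Nat.add_sub_cancel' (not_lt.mp hn)]

end NormalizedPeriodIntegral

open NormalizedPeriodIntegral in
/-- **Stub C of line `Sketch` (crux `SomeWindowSaving`)**: the two sublevel-set estimates (B1)
`vol{s ∈ [−2,2] : 0 < p < η} ≤ C₁η/|D|` (`η ≤ c₁|D|`) and (B2) `≤ C₂√η` (`η ≤ η₀`, normalized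
cubics) imply the uniform bound `∫_{p>0} ds/√p(s) ≤ A + B·|log |D||` for the normalized cubic
`p(s) = 4s³ − G₂s − G₃`, `|G₂|,|G₃| ≤ 1`, `|G₂| = 1 ∨ |G₃| = 1`, `D = G₂³ − 27G₃² ≠ 0`.
Dyadic-shell (layer-cake) assembly, see the module docstring. -/
theorem stub_normalizedPeriodIntegral :
    (∃ c₁ C₁ : ℝ, 0 < c₁ ∧ 0 < C₁ ∧ ∀ G₂ G₃ η : ℝ, |G₂| ≤ 1 → |G₃| ≤ 1 → 0 < η →
      η ≤ c₁ * |G₂ ^ 3 - 27 * G₃ ^ 2| →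
        volume {s : ℝ | s ∈ Set.Icc (-2 : ℝ) 2 ∧ 0 < 4 * s ^ 3 - G₂ * s - G₃ ∧
            4 * s ^ 3 - G₂ * s - G₃ < η} ≤
          ENNReal.ofReal (C₁ * η / |G₂ ^ 3 - 27 * G₃ ^ 2|)) →
    (∃ η₀ C₂ : ℝ, 0 < η₀ ∧ 0 < C₂ ∧ ∀ G₂ G₃ η : ℝ, |G₂| ≤ 1 → |G₃| ≤ 1 → (|G₂| = 1 ∨ |G₃| = 1) →
      0 < η → η ≤ η₀ →
        volume {s : ℝ | s ∈ Set.Icc (-2 : ℝ) 2 ∧ 0 < 4 * s ^ 3 - G₂ * s - G₃ ∧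
            4 * s ^ 3 - G₂ * s - G₃ < η} ≤ ENNReal.ofReal (C₂ * Real.sqrt η)) →
    ∃ A B : ℝ, 0 ≤ A ∧ 0 ≤ B ∧ ∀ G₂ G₃ : ℝ, |G₂| ≤ 1 → |G₃| ≤ 1 → (|G₂| = 1 ∨ |G₃| = 1) →
      G₂ ^ 3 - 27 * G₃ ^ 2 ≠ 0 →
        ∫ s in {s : ℝ | 0 < 4 * s ^ 3 - G₂ * s - G₃}, (Real.sqrt (4 * s ^ 3 - G₂ * s - G₃))⁻¹ ≤
          A + B * |Real.log (|G₂ ^ 3 - 27 * G₃ ^ 2|)| := by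
  rintro ⟨c₁, C₁, hc₁, hC₁, H1⟩ ⟨η₀, C₂, hη₀, hC₂, H2⟩
  -- the constants
  set tailC : ℝ≥0∞ := ∫⁻ s in Ioi (2 : ℝ), ENNReal.ofReal (s ^ (-(3 / 2 : ℝ))) with htailC
  have hT : tailC ≠ ∞ := tail_lt_top.ne
  set κ : ℝ := min 1 (c₁ / (28 * η₀)) with hκ_def
  have hκ0 : 0 < κ := lt_min one_pos (by positivity)
  have hκ1 : κ ≤ 1 := min_le_left _ _
  have hκc : 28 * η₀ * κ ^ 2 ≤ c₁ := by
    have h1 : κ ≤ c₁ / (28 * η₀) := min_le_right _ _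
    have h2 : κ ^ 2 ≤ 1 * (c₁ / (28 * η₀)) := by
      rw [sq]; exact mul_le_mul hκ1 h1 hκ0.le zero_le_one
    rw [one_mul, le_div_iff₀ (by positivity)] at h2
    linarith
  have hlog2 : 0 < Real.log 2 := Real.log_pos (by norm_num)
  have hlogκ : 0 ≤ Real.log (1 / κ) := Real.log_nonneg ((one_le_div hκ0).mpr hκ1)
  have hsq : 0 < Real.sqrt η₀ := Real.sqrt_pos.mpr hη₀
  -- the dyadic levels `uₙ = (√η₀/2)·2⁻ⁿ`
  obtain ⟨u, hu⟩ : ∃ u : ℕ → ℝ, ∀ n, u n = Real.sqrt η₀ / 2 * (1 / 2) ^ n := ⟨_, fun _ => rfl⟩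
  have hu0 : ∀ n, 0 < u n := fun n => by rw [hu]; positivity
  have hu2 : ∀ n, u n ^ 2 = η₀ / 4 * (1 / 4) ^ n := fun n => by
    rw [hu, mul_pow, div_pow, Real.sq_sqrt hη₀.le, ← pow_mul, mul_comm n 2, pow_mul]; norm_num
  refine ⟨tailC.toReal + 8 / Real.sqrt η₀ + 4 * C₂ + 4 * C₂ / Real.log 2 * Real.log (1 / κ) +
      8 * C₁ * Real.sqrt η₀ * κ, 4 * C₂ / Real.log 2, by positivity, by positivity, ?_⟩
  intro G₂ G₃ hG₂ hG₃ hnorm hD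
  set D : ℝ := G₂ ^ 3 - 27 * G₃ ^ 2 with hD_def
  have hD0 : 0 < |D| := abs_pos.mpr hD
  have hD28 : |D| ≤ 28 := abs_disc_le hG₂ hG₃
  set θ : ℝ := κ * |D| with hθ_def
  have hθ0 : 0 < θ := mul_pos hκ0 hD0
  set L : ℝ := Real.log (1 / κ) + |Real.log (|D|)| with hL_def
  have hL0 : 0 ≤ L := by positivity
  set N : ℕ := ⌈-Real.log θ / Real.log 2⌉₊ with hN_def
  -- `2^{-N} ≤ θ`
  have hNθ : (1 / 2 : ℝ) ^ N ≤ θ := by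
    have hN : -Real.log θ / Real.log 2 ≤ N := Nat.le_ceil _
    rw [div_le_iff₀ hlog2] at hN
    rw [← Real.log_le_log_iff (by positivity) hθ0, Real.log_pow, one_div, Real.log_inv]
    linarith
  -- `N ≤ 1 + L / log 2`
  have hNL : (N : ℝ) ≤ L / Real.log 2 + 1 := by
    have h1 : -Real.log θ ≤ L := by
      rw [hθ_def, hL_def, Real.log_mul hκ0.ne' hD0.ne', one_div, Real.log_inv]
      linarith [neg_abs_le (Real.log |D|)]
    have h2 : N ≤ ⌈L / Real.log 2⌉₊ :=
      Nat.ceil_le_ceil (div_le_div_of_nonneg_right h1 hlog2.le)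
    calc (N : ℝ) ≤ (⌈L / Real.log 2⌉₊ : ℝ) := by exact_mod_cast h2
      _ ≤ L / Real.log 2 + 1 := (Nat.ceil_lt_add_one (div_nonneg hL0 hlog2.le)).le
  -- Step 1: the Bochner integral is the `toReal` of the `lintegral`
  have hmeas : Measurable fun s : ℝ => (Real.sqrt (4 * s ^ 3 - G₂ * s - G₃))⁻¹ :=
    (by fun_prop : Continuous fun s : ℝ => 4 * s ^ 3 - G₂ * s - G₃).measurable.sqrt.inv
  rw [integral_eq_lintegral_of_nonneg_ae
    (Filter.Eventually.of_forall fun s => inv_nonneg.mpr (Real.sqrt_nonneg _))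
    hmeas.aestronglyMeasurable]
  refine ENNReal.toReal_le_of_le_ofReal (by positivity) ?_
  -- local names for the integrand, the shells and the high part
  set f : ℝ → ℝ≥0∞ := fun s => ENNReal.ofReal ((Real.sqrt (4 * s ^ 3 - G₂ * s - G₃))⁻¹) with hf
  set E : ℕ → Set ℝ := fun n => {s : ℝ | s ∈ Icc (-2 : ℝ) 2 ∧
    (u n / 2) ^ 2 < 4 * s ^ 3 - G₂ * s - G₃ ∧ 4 * s ^ 3 - G₂ * s - G₃ ≤ u n ^ 2} with hE
  set Hi : Set ℝ := {s : ℝ | s ∈ Icc (-2 : ℝ) 2 ∧ η₀ / 4 < 4 * s ^ 3 - G₂ * s - G₃} with hHi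
  -- Step 2: the shells, via (B2) and via (B1)
  have hshell₂ : ∀ n : ℕ, ∫⁻ s in E n, f s ≤ ENNReal.ofReal (4 * C₂) := by
    intro n
    have hv := hu0 n
    have hη : (2 * u n) ^ 2 ≤ η₀ := by
      rw [mul_pow, hu2]
      have : (1 / 4 : ℝ) ^ n ≤ 1 := pow_le_one₀ (by norm_num) (by norm_num)
      nlinarith
    calc ∫⁻ s in E n, f s ≤ ENNReal.ofReal (2 / u n) * volume {s : ℝ | s ∈ Icc (-2 : ℝ) 2 ∧
          0 < 4 * s ^ 3 - G₂ * s - G₃ ∧ 4 * s ^ 3 - G₂ * s - G₃ < (2 * u n) ^ 2} := shell_le (hu0 n)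
      _ ≤ ENNReal.ofReal (2 / u n) * ENNReal.ofReal (C₂ * Real.sqrt ((2 * u n) ^ 2)) :=
          mul_le_mul_right (H2 G₂ G₃ _ hG₂ hG₃ hnorm (by positivity) hη) _
      _ = ENNReal.ofReal (4 * C₂) := by
          rw [Real.sqrt_sq (by positivity), ← ENNReal.ofReal_mul (by positivity)]
          congr 1; field_simp [(hu0 n).ne']; ring
  have hshell₁ : ∀ j : ℕ, ∫⁻ s in E (N + j), f s ≤
      ENNReal.ofReal (4 * C₁ * Real.sqrt η₀ * κ * (1 / 2) ^ j) := by
    intro j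
    have hv := hu0 (N + j)
    have hη : (2 * u (N + j)) ^ 2 ≤ c₁ * |D| := by
      rw [mul_pow, hu2, pow_add]
      have h1 : (1 / 4 : ℝ) ^ N * (1 / 4) ^ j ≤ θ ^ 2 :=
        calc (1 / 4 : ℝ) ^ N * (1 / 4) ^ j ≤ (1 / 4) ^ N :=
              mul_le_of_le_one_right (by positivity) (pow_le_one₀ (by norm_num) (by norm_num))
          _ = ((1 / 2) ^ N) ^ 2 := by rw [← pow_mul, mul_comm, pow_mul]; norm_num
          _ ≤ θ ^ 2 := pow_le_pow_left₀ (by positivity) hNθ 2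
      calc 2 ^ 2 * (η₀ / 4 * ((1 / 4 : ℝ) ^ N * (1 / 4) ^ j)) ≤ 2 ^ 2 * (η₀ / 4 * θ ^ 2) := by
            gcongr
        _ = (η₀ * κ ^ 2 * |D|) * |D| := by rw [hθ_def]; ring
        _ ≤ (η₀ * κ ^ 2 * 28) * |D| := by gcongr
        _ ≤ c₁ * |D| := by gcongr; linarith
    calc ∫⁻ s in E (N + j), f s
        ≤ ENNReal.ofReal (2 / u (N + j)) * volume {s : ℝ | s ∈ Icc (-2 : ℝ) 2 ∧
          0 < 4 * s ^ 3 - G₂ * s - G₃ ∧ 4 * s ^ 3 - G₂ * s - G₃ < (2 * u (N + j)) ^ 2} :=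
          shell_le hv
      _ ≤ ENNReal.ofReal (2 / u (N + j)) *
            ENNReal.ofReal (C₁ * (2 * u (N + j)) ^ 2 / |D|) :=
          mul_le_mul_right (H1 G₂ G₃ _ hG₂ hG₃ (by positivity) hη) _
      _ = ENNReal.ofReal (8 * C₁ / |D| * u (N + j)) := by
          rw [← ENNReal.ofReal_mul (by positivity)]
          congr 1; field_simp; ring
      _ ≤ ENNReal.ofReal (4 * C₁ * Real.sqrt η₀ * κ * (1 / 2) ^ j) := by
          refine ENNReal.ofReal_le_ofReal ?_
          rw [hu, pow_add]
          have h2 : (1 / 2 : ℝ) ^ N / |D| ≤ κ := by rw [div_le_iff₀ hD0]; exact hNθ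
          calc 8 * C₁ / |D| * (Real.sqrt η₀ / 2 * ((1 / 2) ^ N * (1 / 2) ^ j))
              = 4 * C₁ * Real.sqrt η₀ * (1 / 2) ^ j * ((1 / 2) ^ N / |D|) := by
                field_simp; ring
            _ ≤ 4 * C₁ * Real.sqrt η₀ * (1 / 2) ^ j * κ := by gcongr
            _ = 4 * C₁ * Real.sqrt η₀ * κ * (1 / 2) ^ j := by ring
  -- Step 3: assemble along the cover
  have hcov := cover (G₂ := G₂) (G₃ := G₃) hG₂ hG₃ hη₀ hu2 N
  calc ∫⁻ s in {s : ℝ | 0 < 4 * s ^ 3 - G₂ * s - G₃}, f s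
      ≤ ∫⁻ s in ((Ioi (2 : ℝ) ∪ Hi) ∪ ⋃ i : Fin N, E i) ∪ ⋃ j : ℕ, E (N + j), f s :=
        lintegral_mono_set hcov
    _ ≤ (((∫⁻ s in Ioi (2 : ℝ), f s) + ∫⁻ s in Hi, f s) + ∫⁻ s in ⋃ i : Fin N, E i, f s) +
          ∫⁻ s in ⋃ j : ℕ, E (N + j), f s :=
        (lintegral_union_le _ _ _).trans (add_le_add_left ((lintegral_union_le _ _ _).trans
          (add_le_add_left (lintegral_union_le _ _ _) _)) _)
    _ ≤ ((tailC + ENNReal.ofReal (8 / Real.sqrt η₀)) + (N : ℝ≥0∞) * ENNReal.ofReal (4 * C₂)) +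
          ENNReal.ofReal (8 * C₁ * Real.sqrt η₀ * κ) := by
        refine add_le_add (add_le_add (add_le_add (tail_le hG₂ hG₃) (high_le hη₀)) ?_) ?_
        · calc ∫⁻ s in ⋃ i : Fin N, E i, f s ≤ ∑' i : Fin N, ∫⁻ s in E i, f s :=
                lintegral_iUnion_le _ _
            _ ≤ ∑' _ : Fin N, ENNReal.ofReal (4 * C₂) := ENNReal.tsum_le_tsum fun i => hshell₂ i
            _ = (N : ℝ≥0∞) * ENNReal.ofReal (4 * C₂) := by
                rw [tsum_fintype, Finset.sum_const, Finset.card_univ, Fintype.card_fin,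
                  nsmul_eq_mul]
        · calc ∫⁻ s in ⋃ j : ℕ, E (N + j), f s ≤ ∑' j : ℕ, ∫⁻ s in E (N + j), f s :=
                lintegral_iUnion_le _ _
            _ ≤ ∑' j : ℕ, ENNReal.ofReal (4 * C₁ * Real.sqrt η₀ * κ * (1 / 2) ^ j) :=
                ENNReal.tsum_le_tsum fun j => hshell₁ j
            _ = ENNReal.ofReal (∑' j : ℕ, 4 * C₁ * Real.sqrt η₀ * κ * (1 / 2) ^ j) :=
                (ENNReal.ofReal_tsum_of_nonneg (fun j => by positivity)
                  (summable_geometric_two.mul_left _)).symm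
            _ = ENNReal.ofReal (8 * C₁ * Real.sqrt η₀ * κ) := by
                rw [tsum_mul_left, tsum_geometric_two]; congr 1; ring
    _ = ENNReal.ofReal (tailC.toReal + 8 / Real.sqrt η₀ + N * (4 * C₂) +
          8 * C₁ * Real.sqrt η₀ * κ) := by
        rw [ENNReal.ofReal_add (by positivity) (by positivity),
          ENNReal.ofReal_add (by positivity) (by positivity),
          ENNReal.ofReal_add (by positivity) (by positivity), ENNReal.ofReal_toReal hT,
          ENNReal.ofReal_mul (p := (N : ℝ)) (Nat.cast_nonneg N), ENNReal.ofReal_natCast]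
    _ ≤ ENNReal.ofReal (tailC.toReal + 8 / Real.sqrt η₀ + 4 * C₂ +
          4 * C₂ / Real.log 2 * Real.log (1 / κ) + 8 * C₁ * Real.sqrt η₀ * κ +
          4 * C₂ / Real.log 2 * |Real.log (|D|)|) := by
        refine ENNReal.ofReal_le_ofReal ?_
        have h : (N : ℝ) * (4 * C₂) ≤ 4 * C₂ + 4 * C₂ / Real.log 2 * Real.log (1 / κ) +
            4 * C₂ / Real.log 2 * |Real.log (|D|)| :=
          calc (N : ℝ) * (4 * C₂) ≤ (L / Real.log 2 + 1) * (4 * C₂) :=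
                mul_le_mul_of_nonneg_right hNL (by positivity)
            _ = _ := by rw [hL_def]; field_simp; ring
        linarith
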